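import Literature.AlgebraicGeometry.Surfaces.K3SymplecticAutomorphismRealMultiplication
import Literature.AlgebraicGeometry.Surfaces.K3PowersHodgeOfTranscendentalLattice
import HarnessLib

/-!
# `√3`-multiplication on a K3 surface whose rational transcendental lattice embeds into
# `(U³ ⊕ A₂²) ⊗ ℚ` is algebraic (Varesco, Math. Z. 305 (2023), Thm. 2.1 for `p = 3` with Prop. 2.11) — NAMED FACT

Family `hodge`, layer `Literature/AlgebraicGeometry/Surfaces`. NAMED FACT (D-0014, statement only) for
route HodgeConjecture/MarkmanPartnerTransport, crux `PicardThreeK3Squares` (stmt-HodgeConjecture-19652):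
consumer `Summits/HodgeConjecture/HodgeConjecture/Theorems/MarkmanPartnerTransportPicardThreeK3SquaresPicardFifteenSqrtThree`
(«HC⁴(S × S) for every projective K3 surface of Picard rank `≥ 15` whose `T(S)` carries a
`√3`-similitude», the `√3`-companion of the tree's `√2` theorems at rank `≥ 12`). Companion of the
REDUCED record `Varesco2023_sqrtMultiplication_algebraic_of_symplecticAutomorphism`
(`K3SymplecticAutomorphismRealMultiplication.lean`: the surface ITSELF carries `σ_p`); the present record
is Thm. 2.1 for `p = 3` in its PRINTED generality ("Hodge isometric to a K3 surface with a symplectic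
automorphism of order 3"), that hypothesis being replaced by its lattice-theoretic EQUIVALENT, Prop. 2.11.

## Source (read at this seat; locators = files of the materialised text `paper:arxiv-2304.02519`)

* [Var23] M. Varesco, *Hodge similarities, algebraic classes, and Kuga–Satake varieties*, Math. Z. 305
  (2023), art. 69 = arXiv:2304.02519 [`Varesco2023`; REFEREED]. **Theorem 2.1** [p0008:L30–L33,
  verbatim]: "Let `X` be a K3 surface Hodge isometric to a K3 surface with a symplectic automorphism of
  prime order `p`. Assume furthermore that `ℚ(√p) ⊆ End_Hdg(T(X))`. Then, the Hodge similarity `√p` is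
  algebraic." (proof [p0008:L35–L37]: Buskin–Huybrechts + the algebraic similarity `β_*π^* : T(Y) → T(X)`
  of multiplier `p`, `Y` the minimal resolution of `X/σ_p`). **§2, `p = 3`** [p0010:L53]: "By
  [Garbagnati–Sarti 2007], a K3 surface `X` admits a symplectic automorphism of order `3` if and only if
  `K₁₂(−2)` is primitively embedded in `NS(X)`, where `K₁₂(−2)` denotes the Coxeter–Todd lattice with the
  bilinear form multiplied by `−2`. With a similar proof as in Proposition 2.5, we can reformulate this
  in terms of the transcendental lattice as follows: **Proposition 2.11.** A K3 surface `X` is Hodge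
  isometric to a K3 surface admitting a symplectic automorphism of order `3` if and only if
  `T(X) ⊆ U³_ℚ ⊕ (A₂)²_ℚ`." Introduction [p0004:L1]: "The condition '`X` is Hodge isometric to a K3
  surface with a symplectic automorphism of order `p`' is equivalent to […] `T(X) ↪ U³_ℚ ⊕ (A₂)²_ℚ` for
  `p = 3`." **Theorem 2.15** [p0011:L40–L43]: "For every K3 surface in the two-dimensional families of
  K3 surfaces with endomorphism field containing `ℚ(√3)` which are Hodge isometric to a K3 surface with
  a symplectic automorphism of order `3`, the endomorphism `√3` is algebraic. In particular, the Hodge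
  conjecture holds for the square of every such K3 surface."; **Remark 2.16** [p0011:L45–L48]: "the
  endomorphism field of such K3 surface is either `ℚ(√3)` or a CM field."; **Remark 2.2** [p0008:L41–
  L43] (a Rosati-fixed similitude `ψ` of multiplier `d` has `ψ²/d = id`).
* [GS07] A. Garbagnati, A. Sarti, *Symplectic automorphisms of prime order on K3 surfaces*, J. Algebra
  318 (2007) 323–350 = arXiv:math/0603742 (held `paper:arxiv-math_0603742`), **Thm. 5.1** [p0008:L14]:
  "`p = 3`: `H²(X,ℤ)^{σ₃^*} = U ⊕ U(3) ⊕ U(3) ⊕ A₂ ⊕ A₂`, `(H²(X,ℤ)^{σ₃^*})^⊥ = […] = K₁₂(−2)`" (the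
  `A₂` summands negative definite: the example `T_X = U ⊕ U(3) ⊕ A₂ ⊕ A₂` of signature `(2,6)`,
  [p0009:L57]); so `(K₁₂(−2))^⊥ ⊗ ℚ = (U ⊕ U(3)² ⊕ A₂²) ⊗ ℚ`, of signature `(3,7)`.

## Rendering (tree carriers) and faithfulness

* "K3 surface" ([Var23] §1: complex projective): `Surfaces.IsK3Surface S`; `T(X)` with its intersection
  form: the cup-orthogonal complement `transcendentalSubspace S` of `N¹H²`, read through a MARKING
  `η : H²(S(ℂ); ℂ) ≅ Λ_ℂ = ℂ^{K3Index}` (integral classes `↔ Λ = ℤ²²`, cup product `=` K3 form `• p`,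
  `p` the positive generator of `H⁴`; the clauses of `Huybrechts_K3_marking_exists`), exactly as in the
  tree's record `Floccari2026_hodgeClasses_algebraic_powers_of_K3_of_transcendental_embedding`
  (`K3PowersHodgeOfTranscendentalLattice.lean`): the RATIONAL transcendental lattice `T(X)_ℚ` is the set
  of rational coordinate vectors `v ∈ ℚ²²` with `η⁻¹(v) ∈ T(S)` (`IsTranscendentalCoord S η v`), with
  the form `k3FormRat`.
* "`T(X) ⊆ U³_ℚ ⊕ (A₂)²_ℚ`" (an embedding of rational quadratic spaces, as in the proof of Prop. 2.5
  [p0009:L38]: "an embedding of quadratic spaces `T(X) ↪ U³_ℚ ⊕ E₈(−2)_ℚ`"): a `ℚ`-linear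
  `ι : ℚ²² → ℚ¹⁰` which on the transcendental coordinate vectors is ISOMETRIC for the DIAGONAL form
  `⟨1, 1, 1, −1, −1, −1, −2, −6, −2, −6⟩` and INJECTIVE. That diagonal form IS `(U³ ⊕ A₂²) ⊗ ℚ` up to
  rational isometry: `U ⊗ ℚ ≅ ⟨1, −1⟩` (`2xy = u² − v²`, `x = u + v`, `2y = u − v`; likewise `U(3)`),
  and for the negative definite `A₂` (Gram `−(2, −1; −1, 2)`), `−2x² + 2xy − 2y² = −2(x − y/2)² − (3/2)y²
  ≅ ⟨−2, −3/2⟩ ≅ ⟨−2, −6⟩` (the computation of [Var23] Prop. 2.12's proof, "`Q₃ = Q₄ = ⟨−2⟩ ⊕ ⟨−3/2⟩`",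
  [p0011:L10]). Only the rational isometry class of the target enters Prop. 2.11.
* "`ℚ(√3) ⊆ End_Hdg(T(X))`, the Hodge similarity `√3`" (Rem. 2.2): as in the reduced record — a
  `ℂ`-linear `ψ` on `H²(S(ℂ); ℂ)` mapping `transcendentalSubspace S` into itself, rational and
  Hodge-type-preserving there, with `ψ(ψ x) = 3·x` and `(ψx · ψy) = 3·(x · y)` on it (self-adjointness
  then follows, `cupProduct_selfAdjoint_of_sq_of_multiplier`).
* "is algebraic": some `T` induced by an algebraic cycle on `S × S` (`HodgeTheory.IsAlgebraicCorrespondence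
  2 2 S S T`, `ℂ`-span convention) agrees with `ψ` on `transcendentalSubspace S` — verbatim the
  conclusion of the reduced record.
* WEAKER-OR-EQUAL THAN PRINT: the record is Thm. 2.1 (`p = 3`) composed with the "if" half of Prop. 2.11;
  nothing is asserted about `p ≠ 3`, about the Hodge conjecture, or about the existence of such surfaces
  (Prop. 2.12 / Example 2.13 — not recorded).

## Content and D-0026 accounting

ONE named fact (+1; absent before: `lean search 'sqrtThree|Prop. 2.11|A₂\)²|Coxeter|K_12|K₁₂'` finds
only the reduced `σ_p`-on-`S` record and no lattice criterion for order `3`) and its `Iff.rfl` unfolding;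
no definition with body, no instance, no notation, no sorry (statement-only file). NOT here: Prop. 2.11's "only if" half; the `K₁₂(−2) ↪ NS(X)`
criterion itself ([GS07], Garbagnati–Sarti 2009); Prop. 2.12–Example 2.13 (the two-dimensional
families); any proof.
-/

noncomputable section

open CategoryTheory
open Literature.AlgebraicTopology.SingularHomology

namespace Literature.AlgebraicGeometry.Surfaces

open HodgeTheory

/-- **Varesco 2023, Thm. 2.1 for `p = 3` with Prop. 2.11 — on a projective K3 surface whose rational
transcendental lattice embeds isometrically into `(U³ ⊕ A₂²) ⊗ ℚ ≅ ⟨1,1,1,−1,−1,−1,−2,−6,−2,−6⟩`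
(equivalently [Prop. 2.11]: Hodge isometric to a K3 surface with a symplectic automorphism of order `3`),
a Hodge similitude `ψ = √3` of `T(S)` (multiplier `3`, `ψ² = 3`) is induced by an algebraic cycle on
`S × S`.** Print: Thm. 2.1 "Let `X` be a K3 surface Hodge isometric to a K3 surface with a symplectic
automorphism of prime order `p`. Assume furthermore that `ℚ(√p) ⊆ End_Hdg(T(X))`. Then, the Hodge
similarity `√p` is algebraic." and Prop. 2.11 "A K3 surface `X` is Hodge isometric to a K3 surface
admitting a symplectic automorphism of order `3` if and only if `T(X) ⊆ U³_ℚ ⊕ (A₂)²_ℚ`." Rendering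
(module docstring): through a marking `(η, p)` of `S`, a `ℚ`-linear `ι : ℚ²² → ℚ¹⁰` isometric on the
transcendental coordinate vectors (`IsTranscendentalCoord S η`) for the diagonal form with weights
`(1,1,1,−1,−1,−1,−2,−6,−2,−6)` and injective there; `ψ` maps `transcendentalSubspace S` to itself, is
rational and type-preserving there, `ψ(ψx) = 3x`, `(ψx · ψy) = 3(x · y)`; conclusion: some algebraic
correspondence `T` agrees with `ψ` on `transcendentalSubspace S`. A THEOREM in print (REFEREED, Math. Z.
2023; unproved in the tree). [cite: Varesco2023, Thm. 2.1 (§2, p0008:L30–L37), Prop. 2.11 (p0010:L53–L58), Thm. 2.15 and Rem. 2.16]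
[cite: GarbagnatiSarti2007, Thm. 5.1 (`p = 3`)] -/
def Varesco2023_sqrtThree_algebraic_of_transcendental_embedding : Prop :=
  ∀ ⦃S : Motives.SchemeOver ℂ⦄ (_hS : IsK3Surface S)
    (η : complexBetti S (2 * 1) ≃ₗ[ℂ] (K3Index → ℂ)) (p : complexBetti S (2 * 2)),
    p ≠ 0 → IsIntegralClass p →
    (∀ q : complexBetti S (2 * 2), IsIntegralClass q → ∃ n : ℤ, q = n • p) →
    (∀ c : complexBetti S (2 * 1), IsIntegralClass c ↔ ∃ v : K3Index → ℤ, η c = fun i => (v i : ℂ)) →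
    (∀ a b : complexBetti S (2 * 1),
      cupProduct (rfl : 2 * 1 + 2 * 1 = 2 * 2) a b = k3Form (η a) (η b) • p) →
  ∀ (ι : (K3Index → ℚ) →ₗ[ℚ] (Fin 10 → ℚ)),
    (∀ v w : K3Index → ℚ, IsTranscendentalCoord S η v → IsTranscendentalCoord S η w →
      ∑ i : Fin 10, (![1, 1, 1, -1, -1, -1, -2, -6, -2, -6] : Fin 10 → ℚ) i * ι v i * ι w i =
        k3FormRat v w) →
    (∀ v : K3Index → ℚ, IsTranscendentalCoord S η v → ι v = 0 → v = 0) →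
  ∀ (ψ : complexBetti S (2 * 1) →ₗ[ℂ] complexBetti S (2 * 1)),
    Set.MapsTo ψ (transcendentalSubspace S) (transcendentalSubspace S) →
    (∀ x ∈ transcendentalSubspace S, IsRationalClass x → IsRationalClass (ψ x)) →
    (∀ (i j : ℕ), ∀ x ∈ transcendentalSubspace S,
      IsOfHodgeType 2 S (2 * 1) i j x → IsOfHodgeType 2 S (2 * 1) i j (ψ x)) →
    (∀ x ∈ transcendentalSubspace S, ψ (ψ x) = (3 : ℂ) • x) →
    (∀ x ∈ transcendentalSubspace S, ∀ y ∈ transcendentalSubspace S,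
      cupProduct (rfl : 2 * 1 + 2 * 1 = 2 * 2) (ψ x) (ψ y) =
        (3 : ℂ) • cupProduct (rfl : 2 * 1 + 2 * 1 = 2 * 2) x y) →
  ∃ T : complexBetti S (2 * 1) →ₗ[ℂ] complexBetti S (2 * 1),
    IsAlgebraicCorrespondence 2 2 S S T ∧ ∀ x ∈ transcendentalSubspace S, T x = ψ x

/-- Unfolding of `Varesco2023_sqrtThree_algebraic_of_transcendental_embedding` (statement-only file:
consumers apply the fact directly to marked data `η, p`, an embedding `ι` and a `√3`-similitude `ψ`;
self-adjointness of `ψ` on `T(S)` follows from the clauses by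
`cupProduct_selfAdjoint_of_sq_of_multiplier`, and on a surface that itself carries a symplectic
automorphism of order `3` the reduced record `Varesco2023_sqrtMultiplication_algebraic_of_symplecticAutomorphism`
gives the same conclusion without `ι`). [cite: Varesco2023, Thm. 2.1 and Prop. 2.11] -/
theorem varesco2023_sqrtThree_algebraic_of_transcendental_embedding_iff :
    Varesco2023_sqrtThree_algebraic_of_transcendental_embedding ↔
      ∀ ⦃S : Motives.SchemeOver ℂ⦄ (_hS : IsK3Surface S)
        (η : complexBetti S (2 * 1) ≃ₗ[ℂ] (K3Index → ℂ)) (p : complexBetti S (2 * 2)),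
        p ≠ 0 → IsIntegralClass p →
        (∀ q : complexBetti S (2 * 2), IsIntegralClass q → ∃ n : ℤ, q = n • p) →
        (∀ c : complexBetti S (2 * 1), IsIntegralClass c ↔ ∃ v : K3Index → ℤ, η c = fun i => (v i : ℂ)) →
        (∀ a b : complexBetti S (2 * 1),
          cupProduct (rfl : 2 * 1 + 2 * 1 = 2 * 2) a b = k3Form (η a) (η b) • p) →
      ∀ (ι : (K3Index → ℚ) →ₗ[ℚ] (Fin 10 → ℚ)),
        (∀ v w : K3Index → ℚ, IsTranscendentalCoord S η v → IsTranscendentalCoord S η w →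
          ∑ i : Fin 10, (![1, 1, 1, -1, -1, -1, -2, -6, -2, -6] : Fin 10 → ℚ) i * ι v i * ι w i =
            k3FormRat v w) →
        (∀ v : K3Index → ℚ, IsTranscendentalCoord S η v → ι v = 0 → v = 0) →
      ∀ (ψ : complexBetti S (2 * 1) →ₗ[ℂ] complexBetti S (2 * 1)),
        Set.MapsTo ψ (transcendentalSubspace S) (transcendentalSubspace S) →
        (∀ x ∈ transcendentalSubspace S, IsRationalClass x → IsRationalClass (ψ x)) →
        (∀ (i j : ℕ), ∀ x ∈ transcendentalSubspace S,
          IsOfHodgeType 2 S (2 * 1) i j x → IsOfHodgeType 2 S (2 * 1) i j (ψ x)) →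
        (∀ x ∈ transcendentalSubspace S, ψ (ψ x) = (3 : ℂ) • x) →
        (∀ x ∈ transcendentalSubspace S, ∀ y ∈ transcendentalSubspace S,
          cupProduct (rfl : 2 * 1 + 2 * 1 = 2 * 2) (ψ x) (ψ y) =
            (3 : ℂ) • cupProduct (rfl : 2 * 1 + 2 * 1 = 2 * 2) x y) →
      ∃ T : complexBetti S (2 * 1) →ₗ[ℂ] complexBetti S (2 * 1),
        IsAlgebraicCorrespondence 2 2 S S T ∧ ∀ x ∈ transcendentalSubspace S, T x = ψ x :=
  Iff.rfl


end Literature.AlgebraicGeometry.Surfaces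

end
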